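import Summits.BirchSwinnertonDyer.BirchSwinnertonDyer.Theorems.KolyvaginRoadThreeMethod2ClassesFromBottom
import HarnessLib

/-!
# Route `KolyvaginRoadThree`, deciding crux `ZhangSharpFrameAtThreeHL` (item stmt-BirchSwinnertonDyer-19574):
# the consumed part of stub B closes the circle — given stubs A and P it is EQUIVALENT to the crux at the frame
# (cell `bsd-stepL`, ACCEL seat `bsd-stepL-koly3b` g2; `--supports stmt-BirchSwinnertonDyer-19574`, helper; companion of
# `KolyvaginRoadThreeMethod2ClassesFromBottom.lean`)

HONEST FRAMING. 0 defs, 0 facts, 0 `sorry`; bookkeeping only. PARTITION: O2@3 (B10) × A1 × crux 19574 — none (probe +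
helper; types nothing, closes nothing; T7).

WHAT. `cruxAt_of_rankLowering_of_oddRank_of_consumedCoherent` is the composition `Method2.ZhangSharpFrameAtThreeHL_of` of
the registered skeleton v2x (koly g12) RE-RUN FRAME-WISE on the engine variant
`ZhangInductionOnPos.exists_ne_zero_of_zhangInduction_on_pos_of_rank_ne_zero` (this seat, p471131): from (A1) = stub A
at the frame, the odd bottom rank (= stub P through the eigen-dictionary) and ONLY the consumed part of stub B —
REALISATION, (A2) and (A5) at the parity-coherent good levels `GoodLevel n ∧ (Odd (rank n) ↔ Even #n)`, (A3) at the
NON-EMPTY ones — the crux's conclusion at the frame follows. Together with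
`Method2.stubB_consumedCoherent_of_cruxAt_of_cover` (p471571: the consumed part ⟸ the crux's conclusion at the frame + a
covering family) this gives `cruxAt_iff_consumedCoherent`: GIVEN STUBS A AND P AND A COVERING FAMILY, THE CONSUMED PART OF
STUB B IS EQUIVALENT TO THE CRUX'S CONCLUSION AT THE FRAME. So the registered decomposition A ∧ P ∧ B of crux 19574
isolates in B no brick about level-raised forms: what `_of` takes from B is the crux itself (at each frame), dressed.

References: [cite: WZhang2014, §9 proof of Thm. 9.1 (pp. 240–241), Thm. 9.2].
-/

noncomputable section

open scoped Classical

namespace Summit.BirchSwinnertonDyer.Rank1Residual.X11b.Three.Koly.Method2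

open WeierstrassCurve NumberField IsDedekindDomain
  Literature.NumberTheory.EllipticCurves Literature.NumberTheory.EllipticCurves.ModularForms
  Literature.NumberTheory.GaloisRepresentations Module

variable (W : WeierstrassCurve ℚ) (K : Type) [Field K] [NumberField K] [W.IsGloballyMinimal] (c : K ≃ₐ[ℚ] K)

/-- **The crux at the frame from (A1), the odd bottom rank, and the CONSUMED part of stub B** (= v2x's
`ZhangSharpFrameAtThreeHL_of`, frame-wise, on the engine variant asking (A3) only at non-empty levels). Inputs: (A1) rank
lowering on good levels producing good levels [stub A]; `Odd (dim SelQ ∅⁺ + dim SelQ ∅⁻)` [stub P + eigen-dictionary];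
classes `κ`, index `m₁` with REALISATION, (A2) ∕ (A5) at parity-coherent good levels and (A3) at the non-empty ones.
Output: a non-zero concrete Kolyvagin class of the frame. [cite: WZhang2014, §9 proof of Thm. 9.1 and Thm. 9.2] -/
theorem cruxAt_of_rankLowering_of_oddRank_of_consumedCoherent [W.IsElliptic] [NeZero (W.conductorNorm ℤ)]
    [Module (ZMod 3) (V3 W K)]
    (Dt : ModularParametrizationData W (W.conductorNorm ℤ)) (β : ℤ) (ι : K →+* ℂ)
    -- (A1) = stub A at the frame
    (hA1 : ∀ (n : Finset {q // IsUAdmissiblePrime W K q}) (μ : Bool) (x : V3 W K),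
      GoodLevel W K n → x ∈ SelQ W K c n μ → x ≠ 0 →
      ∃ q : {q // IsUAdmissiblePrime W K q}, q ∉ n ∧ GoodLevel W K (insert q n) ∧
        x ∉ SelQ W K c (insert q n) μ ∧
        SelQ W K c (insert q n) μ ≤ SelQ W K c n μ ∧
        finrank (ZMod 3) (SelQ W K c (insert q n) μ) + 1 = finrank (ZMod 3) (SelQ W K c n μ) ∧
        SelQ W K c (insert q n) (!μ) = SelQ W K c n (!μ))
    -- odd bottom rank (= stub P through `finrank_selmer_eq_finrank_selQ_add`)
    (hodd0 : Odd (finrank (ZMod 3) (SelQ W K c ∅ true) + finrank (ZMod 3) (SelQ W K c ∅ false)))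
    -- the CONSUMED part of stub B
    (hB : ∃ (κ : {x : (n : ℕ) × KolyvaginHeegnerData Dt β ι n //
            KolyvaginDescent.KolSupp (Zhang2014.IsKolyvaginPrime (W.conductorNorm ℤ) W K 3) x.1} →
          Finset {q // IsUAdmissiblePrime W K q} → V3 W K)
      (m₁ : {x : (n : ℕ) × KolyvaginHeegnerData Dt β ι n //
            KolyvaginDescent.KolSupp (Zhang2014.IsKolyvaginPrime (W.conductorNorm ℤ) W K 3) x.1}),
      (∀ m, κ m ∅ = m.1.2.kolyvaginClass Nat.prime_three 1) ∧
      (∀ (n : Finset {q // IsUAdmissiblePrime W K q}) (q₁ q₂ : {q // IsUAdmissiblePrime W K q}),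
        (GoodLevel W K n ∧ (Odd (finrank (ZMod 3) (SelQ W K c n true) + finrank (ZMod 3) (SelQ W K c n false)) ↔
          Even n.card)) →
        (GoodLevel W K (insert q₁ n) ∧ (Odd (finrank (ZMod 3) (SelQ W K c (insert q₁ n) true) +
          finrank (ZMod 3) (SelQ W K c (insert q₁ n) false)) ↔ Even (insert q₁ n).card)) →
        (GoodLevel W K (insert q₂ (insert q₁ n)) ∧
          (Odd (finrank (ZMod 3) (SelQ W K c (insert q₂ (insert q₁ n)) true) +
            finrank (ZMod 3) (SelQ W K c (insert q₂ (insert q₁ n)) false)) ↔ Even (insert q₂ (insert q₁ n)).card)) →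
        q₁ ∉ n → q₂ ∉ insert q₁ n → q₂ ∉ baseLocusQ W K κ (insert q₂ (insert q₁ n)) → ∃ m, κ m n ≠ 0) ∧
      (∀ (n : Finset {q // IsUAdmissiblePrime W K q}),
        (GoodLevel W K n ∧ (Odd (finrank (ZMod 3) (SelQ W K c n true) + finrank (ZMod 3) (SelQ W K c n false)) ↔
          Even n.card)) → n.Nonempty → Even n.card → (∃ m, κ m n ≠ 0) →
        ∃ (s : Bool) (d : ℕ), finrank (ZMod 3) (SelQ W K c n s) = d + 1 ∧
          SelQ W K c n s = SelRelQ W K c n (baseLocusQ W K κ n) s ∧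
          FiniteDimensional (ZMod 3) (SelRelQ W K c n (baseLocusQ W K κ n) (!s)) ∧
          finrank (ZMod 3) (SelRelQ W K c n (baseLocusQ W K κ n) (!s)) ≤ d) ∧
      (∀ (n : Finset {q // IsUAdmissiblePrime W K q}),
        (GoodLevel W K n ∧ (Odd (finrank (ZMod 3) (SelQ W K c n true) + finrank (ZMod 3) (SelQ W K c n false)) ↔
          Even n.card)) → Even n.card →
        finrank (ZMod 3) (SelQ W K c n true) + finrank (ZMod 3) (SelQ W K c n false) = 1 → κ m₁ n ≠ 0)) :
    ∃ (n : ℕ) (d : KolyvaginHeegnerData Dt β ι n),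
      KolyvaginDescent.KolSupp (Zhang2014.IsKolyvaginPrime (W.conductorNorm ℤ) W K 3) n ∧
        d.kolyvaginClass Nat.prime_three 1 ≠ 0 := by
  obtain ⟨κ, m₁, hbot, hA2, hA3, hA5⟩ := hB
  -- the PARITY-COHERENT good levels: the levels the induction visits (v2w ∕ v2x)
  let Good : Finset {q // IsUAdmissiblePrime W K q} → Prop := fun n ↦
    GoodLevel W K n ∧
      (Odd (finrank (ZMod 3) (SelQ W K c n true) + finrank (ZMod 3) (SelQ W K c n false)) ↔ Even n.card)
  have hgood0 : Good ∅ :=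
    ⟨goodLevel_empty W K, by simp only [Finset.card_empty, Even.zero, iff_true]; exact hodd0⟩
  -- (A1) produces parity-coherent good levels: total rank −1, cardinality +1 (koly g12's bookkeeping, verbatim)
  have eA1 : ∀ (n : Finset {q // IsUAdmissiblePrime W K q}) (μ : Bool) (x : V3 W K), Good n →
      x ∈ SelQ W K c n μ → x ≠ 0 →
      ∃ q : {q // IsUAdmissiblePrime W K q}, q ∉ n ∧ Good (insert q n) ∧ x ∉ SelQ W K c (insert q n) μ ∧
        SelQ W K c (insert q n) μ ≤ SelQ W K c n μ ∧
        finrank (ZMod 3) (SelQ W K c (insert q n) μ) + 1 = finrank (ZMod 3) (SelQ W K c n μ) ∧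
        SelQ W K c (insert q n) (!μ) = SelQ W K c n (!μ) := by
    intro n μ x hg hx hx0
    obtain ⟨q, hqn, hgq, hxq, hle, hrk, hneg⟩ := hA1 n μ x hg.1 hx hx0
    refine ⟨q, hqn, ⟨hgq, ?_⟩, hxq, hle, hrk, hneg⟩
    have hstep : finrank (ZMod 3) (SelQ W K c (insert q n) true) + finrank (ZMod 3) (SelQ W K c (insert q n) false)
        + 1 = finrank (ZMod 3) (SelQ W K c n true) + finrank (ZMod 3) (SelQ W K c n false) := by
      cases μ with
      | false =>
        rw [Bool.not_false] at hneg
        rw [hneg]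
        omega
      | true =>
        rw [Bool.not_true] at hneg
        rw [hneg]
        omega
    have hcoh := hg.2
    rw [Finset.card_insert_of_notMem hqn]
    rw [Nat.odd_iff, Nat.even_iff] at hcoh ⊢
    omega
  have eA2 : ∀ (n : Finset {q // IsUAdmissiblePrime W K q}) (q₁ q₂ : {q // IsUAdmissiblePrime W K q}), Good n →
      Good (insert q₁ n) → Good (insert q₂ (insert q₁ n)) → q₁ ∉ n → q₂ ∉ insert q₁ n →
      q₂ ∉ baseLocusQ W K κ (insert q₂ (insert q₁ n)) → ∃ m, κ m n ≠ 0 :=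
    fun n q₁ q₂ hg hg₁ hg₂ ↦ hA2 n q₁ q₂ hg hg₁ hg₂
  have eA3 : ∀ (n : Finset {q // IsUAdmissiblePrime W K q}), Good n → n.Nonempty → Even n.card → (∃ m, κ m n ≠ 0) →
      ∃ (s : Bool) (d : ℕ), finrank (ZMod 3) (SelQ W K c n s) = d + 1 ∧
        SelQ W K c n s = SelRelQ W K c n (baseLocusQ W K κ n) s ∧
        FiniteDimensional (ZMod 3) (SelRelQ W K c n (baseLocusQ W K κ n) (!s)) ∧
        finrank (ZMod 3) (SelRelQ W K c n (baseLocusQ W K κ n) (!s)) ≤ d :=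
    fun n hg ↦ hA3 n hg
  have eA4 : ∀ (n : Finset {q // IsUAdmissiblePrime W K q}) (q : {q // IsUAdmissiblePrime W K q})
      (S : Set {q // IsUAdmissiblePrime W K q}) (s : Bool), Good n → Good (insert q n) →
      q ∉ n → q ∈ S → SelQ W K c n s ≤ SelRelQ W K c (insert q n) S s :=
    fun n q S s _ _ hqn hqS ↦ relaxation_le W K c n q S s hqn hqS
  have eA5 : ∀ (n : Finset {q // IsUAdmissiblePrime W K q}), Good n → Even n.card →
      finrank (ZMod 3) (SelQ W K c n true) + finrank (ZMod 3) (SelQ W K c n false) = 1 → κ m₁ n ≠ 0 :=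
    fun n hg ↦ hA5 n hg
  -- (A6⁰) at the visited levels is read off the parity coherence
  have eA6 : ∀ (n : Finset {q // IsUAdmissiblePrime W K q}), Good n → Even n.card →
      finrank (ZMod 3) (SelQ W K c n true) + finrank (ZMod 3) (SelQ W K c n false) ≠ 0 := by
    intro n hg he h0
    have hodd : Odd (finrank (ZMod 3) (SelQ W K c n true) + finrank (ZMod 3) (SelQ W K c n false)) := hg.2.mpr he
    rw [h0] at hodd
    exact (Nat.not_odd_iff_even.mpr Even.zero) hodd
  obtain ⟨m, hm⟩ :=
    ZhangInductionOnPos.exists_ne_zero_of_zhangInduction_on_pos_of_rank_ne_zero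
      Good (SelQ W K c) (SelRelQ W K c) (baseLocusQ W K κ) κ m₁ eA1 eA2 eA3 eA4 eA5 eA6 ∅ hgood0 (by simp)
  refine ⟨m.1.1, m.1.2, m.2, fun h0 ↦ hm ?_⟩
  rw [hbot m, h0]

/-- **THE CIRCLE. Given (A1) [stub A], the odd bottom rank [stub P] and a covering family (COV), the consumed part of
stub B is EQUIVALENT to the crux's conclusion at the frame.** (⟹: `cruxAt_of_rankLowering_of_oddRank_of_consumedCoherent`;
⟸: `stubB_consumedCoherent_of_cruxAt_of_cover`, which uses neither (A1) nor parity.) [cite: WZhang2014, §9 proof of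
Thm. 9.1] -/
theorem cruxAt_iff_consumedCoherent [W.IsElliptic] [NeZero (W.conductorNorm ℤ)] [Module (ZMod 3) (V3 W K)]
    (Dt : ModularParametrizationData W (W.conductorNorm ℤ)) (β : ℤ) (ι : K →+* ℂ)
    (hA1 : ∀ (n : Finset {q // IsUAdmissiblePrime W K q}) (μ : Bool) (x : V3 W K),
      GoodLevel W K n → x ∈ SelQ W K c n μ → x ≠ 0 →
      ∃ q : {q // IsUAdmissiblePrime W K q}, q ∉ n ∧ GoodLevel W K (insert q n) ∧
        x ∉ SelQ W K c (insert q n) μ ∧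
        SelQ W K c (insert q n) μ ≤ SelQ W K c n μ ∧
        finrank (ZMod 3) (SelQ W K c (insert q n) μ) + 1 = finrank (ZMod 3) (SelQ W K c n μ) ∧
        SelQ W K c (insert q n) (!μ) = SelQ W K c n (!μ))
    (hodd0 : Odd (finrank (ZMod 3) (SelQ W K c ∅ true) + finrank (ZMod 3) (SelQ W K c ∅ false)))
    (hcov : ∃ j : {x : (n : ℕ) × KolyvaginHeegnerData Dt β ι n //
          KolyvaginDescent.KolSupp (Zhang2014.IsKolyvaginPrime (W.conductorNorm ℤ) W K 3) x.1} → V3 W K,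
      ∀ q : {q // IsUAdmissiblePrime W K q}, ∃ m, ∃ v : HeightOneSpectrum (𝓞 K), ((q : ℕ) : 𝓞 K) ∈ v.asIdeal ∧
        j m ∉ (W.baseChange K).torsionLocalKer (v.adicCompletion K) ((3 ^ 1 : ℕ) : ℤ)) :
    (∃ (n : ℕ) (d : KolyvaginHeegnerData Dt β ι n),
      KolyvaginDescent.KolSupp (Zhang2014.IsKolyvaginPrime (W.conductorNorm ℤ) W K 3) n ∧
        d.kolyvaginClass Nat.prime_three 1 ≠ 0) ↔
    ∃ (κ : {x : (n : ℕ) × KolyvaginHeegnerData Dt β ι n //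
            KolyvaginDescent.KolSupp (Zhang2014.IsKolyvaginPrime (W.conductorNorm ℤ) W K 3) x.1} →
          Finset {q // IsUAdmissiblePrime W K q} → V3 W K)
      (m₁ : {x : (n : ℕ) × KolyvaginHeegnerData Dt β ι n //
            KolyvaginDescent.KolSupp (Zhang2014.IsKolyvaginPrime (W.conductorNorm ℤ) W K 3) x.1}),
      (∀ m, κ m ∅ = m.1.2.kolyvaginClass Nat.prime_three 1) ∧
      (∀ (n : Finset {q // IsUAdmissiblePrime W K q}) (q₁ q₂ : {q // IsUAdmissiblePrime W K q}),
        (GoodLevel W K n ∧ (Odd (finrank (ZMod 3) (SelQ W K c n true) + finrank (ZMod 3) (SelQ W K c n false)) ↔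
          Even n.card)) →
        (GoodLevel W K (insert q₁ n) ∧ (Odd (finrank (ZMod 3) (SelQ W K c (insert q₁ n) true) +
          finrank (ZMod 3) (SelQ W K c (insert q₁ n) false)) ↔ Even (insert q₁ n).card)) →
        (GoodLevel W K (insert q₂ (insert q₁ n)) ∧
          (Odd (finrank (ZMod 3) (SelQ W K c (insert q₂ (insert q₁ n)) true) +
            finrank (ZMod 3) (SelQ W K c (insert q₂ (insert q₁ n)) false)) ↔ Even (insert q₂ (insert q₁ n)).card)) →
        q₁ ∉ n → q₂ ∉ insert q₁ n → q₂ ∉ baseLocusQ W K κ (insert q₂ (insert q₁ n)) → ∃ m, κ m n ≠ 0) ∧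
      (∀ (n : Finset {q // IsUAdmissiblePrime W K q}),
        (GoodLevel W K n ∧ (Odd (finrank (ZMod 3) (SelQ W K c n true) + finrank (ZMod 3) (SelQ W K c n false)) ↔
          Even n.card)) → n.Nonempty → Even n.card → (∃ m, κ m n ≠ 0) →
        ∃ (s : Bool) (d : ℕ), finrank (ZMod 3) (SelQ W K c n s) = d + 1 ∧
          SelQ W K c n s = SelRelQ W K c n (baseLocusQ W K κ n) s ∧
          FiniteDimensional (ZMod 3) (SelRelQ W K c n (baseLocusQ W K κ n) (!s)) ∧
          finrank (ZMod 3) (SelRelQ W K c n (baseLocusQ W K κ n) (!s)) ≤ d) ∧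
      (∀ (n : Finset {q // IsUAdmissiblePrime W K q}),
        (GoodLevel W K n ∧ (Odd (finrank (ZMod 3) (SelQ W K c n true) + finrank (ZMod 3) (SelQ W K c n false)) ↔
          Even n.card)) → Even n.card →
        finrank (ZMod 3) (SelQ W K c n true) + finrank (ZMod 3) (SelQ W K c n false) = 1 → κ m₁ n ≠ 0) :=
  ⟨fun h ↦ stubB_consumedCoherent_of_cruxAt_of_cover W K c Dt β ι h hcov,
    fun h ↦ cruxAt_of_rankLowering_of_oddRank_of_consumedCoherent W K c Dt β ι hA1 hodd0 h⟩

end Summit.BirchSwinnertonDyer.Rank1Residual.X11b.Three.Koly.Method2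

end
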